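import Summits.Ventures.GridStability.Lyapunov.SublevelTrapping
import Mathlib.Topology.Order.Compact
import HarnessLib

/-!
# Reaching a certified target set: soundness of a «funnel» (reach-to-target) certificate along a solution curve

Venture GRIDFUSION (LADDER-GRIDFUSION G1-cct, lever «union-of-sublevels / trajectory-aligned synthesis»,
lead RULING 6i (5) / 6j (2) 2026-08-27), seat gridfusion-sos-3 (g5); namespace
`Summit.Ventures.GridStability.Lyapunov`. Pure analysis in the curve form of `SublevelTrapping.lean`
(which it only USES); nothing here mentions a grid, a machine or a certificate.

THE SHAPE IT SERVES. A certified invariant-and-attracting piece `S₀ = {V₀ ≤ c₀}` (a Lyapunov sublevel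
certificate, `CertificateSoundness.certificate_invariance_tendsto_univ`) is ENLARGED not by a better `V₀` but
by a second function `V₁` that is only asked to DECREASE at a fixed rate `ε > 0` on the piece
`S₁ = {y ∈ M ∩ G | V₁ y ≤ c₁}` OUTSIDE the target (`c₀ < V₀ y`), with the piece fenced away from `∂G` there
(`S₁ ∩ {c₀ < V₀} ⊆ interior G`) and `V₁` bounded below by `m` on `S₁`. No positivity of `V₁`, no condition
near the equilibrium, no invariance of `S₁` is needed: every solution starting in `S₁` REACHES the target
`{V₀ ≤ c₀}` at some time `t₀ ≤ (c₁ - m)/ε`, staying in `S₁` until then (`reach_target_of_deriv_le`). The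
ROA inclusion `S₁ ⊆ ROA` then follows from the target's own certificate applied to the shifted solution —
that composition is done per instance (Bench files), not here.

PROOF. Continuous induction (`forall_mem_sublevel_of_deriv_neg`) on `[0, t]` for every `t` before the
first target time: the strict right derivative `≤ -ε < 0` of `V₁ ∘ x` keeps the curve in the closed piece,
the fencing keeps it inside `G`; the affine comparison `le_add_mul_of_deriv_right_le` gives
`V₁ (x t) ≤ c₁ - ε t`, which is `< m` for `t > (c₁ - m)/ε` — so the target is reached before; the first
target time exists by compactness of `[0, T]` (`IsCompact.exists_isLeast` on the closed set of target times).
[folklore]  References: the «reach a target tube/funnel» use of Lyapunov-like functions is standard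
(e.g. Tedrake et al., LQR-trees / SOS funnels, 2010; Tan–Packard, expanding-interior ROA iterations, 2008);
no single source is followed.
-/

noncomputable section

open Set Filter Topology

namespace Summit.Ventures.GridStability.Lyapunov

variable {X : Type*} [TopologicalSpace X]

/-- **Trapping in the funnel piece before the target is reached.** Let `x` be continuous on `[0, b]`,
in `M` throughout, starting in the closed piece `S₁ = {y ∈ M ∩ G | V₁ y ≤ c₁}`; suppose that on `[0, b)`
the target has NOT been reached (`c₀ < V₀ (x t)`), that the piece is fenced inside `interior G` off the
target, and that `V₁ ∘ x` has right derivative `LV₁ (x t) ≤ -ε < 0` whenever `x t ∈ S₁` is off the target.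
Then `x t ∈ S₁` on all of `[0, b]` and `V₁ (x t) ≤ c₁ - ε t` there. [folklore] -/
theorem forall_mem_funnel_of_not_reached {M G : Set X} {V₀ V₁ LV₁ : X → ℝ} {c₀ c₁ ε b : ℝ}
    {x : ℝ → X} (hS : IsClosed {y ∈ M ∩ G | V₁ y ≤ c₁})
    (hfence : {y ∈ M ∩ G | V₁ y ≤ c₁ ∧ c₀ < V₀ y} ⊆ interior G)
    (hV₁ : Continuous V₁) (hε : 0 < ε)
    (hLie : ∀ y ∈ M ∩ G, V₁ y ≤ c₁ → c₀ < V₀ y → LV₁ y ≤ -ε)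
    (hx : ContinuousOn x (Icc 0 b)) (hxM : ∀ t ∈ Icc 0 b, x t ∈ M)
    (hφ : ∀ t ∈ Ico 0 b, HasDerivWithinAt (V₁ ∘ x) (LV₁ (x t)) (Ici t) t)
    (hnot : ∀ t ∈ Ico 0 b, c₀ < V₀ (x t))
    (h0G : x 0 ∈ G) (h0c : V₁ (x 0) ≤ c₁) :
    ∀ t ∈ Icc 0 b, (x t ∈ G ∧ V₁ (x t) ≤ c₁) ∧ V₁ (x t) ≤ c₁ - ε * t := by
  by_cases hb : 0 ≤ b
  swap
  · intro t ht; exact absurd (ht.1.trans ht.2) hb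
  have hmem : ∀ t ∈ Icc 0 b, x t ∈ M ∩ G ∧ V₁ (x t) ≤ c₁ := by
    refine forall_mem_sublevel_of_deriv_neg (D := M ∩ G) (V := V₁) (c := c₁) hS hx
      ⟨hxM 0 (left_mem_Icc.2 hb), h0G⟩ h0c ?_ ?_
    · intro t ht htD htV
      exact eventually_mem_inter_of_forall_mem_of_subset_interior
        (S := {y ∈ M ∩ G | V₁ y ≤ c₁ ∧ c₀ < V₀ y}) hxM hfence hx ht ⟨htD, htV, hnot t ht⟩
    · intro t ht htD htV
      exact ⟨LV₁ (x t), hφ t ht, fun _ ↦ by linarith [hLie _ htD htV (hnot t ht)]⟩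
  have hcont : ContinuousOn (V₁ ∘ x) (Icc 0 b) := hV₁.comp_continuousOn hx
  have hcmp := le_add_mul_of_deriv_right_le (φ := V₁ ∘ x) (φ' := fun t ↦ LV₁ (x t)) (m := -ε)
    hcont hφ (fun t ht ↦ hLie _ (hmem t (Ico_subset_Icc_self ht)).1 (hmem t (Ico_subset_Icc_self ht)).2
      (hnot t ht))
  intro t ht
  refine ⟨⟨(hmem t ht).1.2, (hmem t ht).2⟩, ?_⟩
  have h := hcmp t ht
  simp only [Function.comp_apply, sub_zero] at h
  linarith [h0c]

/-- **Reach-to-target soundness (funnel certificate, curve form).** Phase space any topological space;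
`M` a set the solution is known to stay in (a first-integral set `{h = 0}`, or `univ`), `G` the certified
domain of the funnel, `S₁ = {y ∈ M ∩ G | V₁ y ≤ c₁}` the funnel piece (closed), `{V₀ ≤ c₀}` the TARGET.
Hypotheses: fencing off the target (`S₁ ∩ {c₀ < V₀} ⊆ interior G`); `V₀`, `V₁` continuous; the CERTIFIED
decrease `LV₁ ≤ -ε` (`ε > 0`) on `S₁ ∩ {c₀ < V₀}` and the lower bound `m ≤ V₁` on `S₁`; a curve `x`
continuous on `[0, ∞)`, in `M` throughout, along which `V₁ ∘ x` has right derivative `LV₁ (x t)` (chain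
rule with the emitted Lie-derivative polynomial), starting in `S₁`. Conclusion: there is a time
`t₀ ∈ [0, (c₁ - m)/ε]` at which the target is reached, `V₀ (x t₀) ≤ c₀`, and `x t ∈ S₁` for all
`t ∈ [0, t₀]`. MODELLED: a statement about one curve; combine with the target's own certificate on the
shifted curve `τ ↦ x (t₀ + τ)` for the ROA reading. [folklore] -/
theorem reach_target_of_deriv_le {M G : Set X} {V₀ V₁ LV₁ : X → ℝ} {c₀ c₁ ε m : ℝ}
    {x : ℝ → X} (hS : IsClosed {y ∈ M ∩ G | V₁ y ≤ c₁})
    (hfence : {y ∈ M ∩ G | V₁ y ≤ c₁ ∧ c₀ < V₀ y} ⊆ interior G)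
    (hV₀ : Continuous V₀) (hV₁ : Continuous V₁) (hε : 0 < ε)
    (hLie : ∀ y ∈ M ∩ G, V₁ y ≤ c₁ → c₀ < V₀ y → LV₁ y ≤ -ε)
    (hm : ∀ y ∈ M ∩ G, V₁ y ≤ c₁ → m ≤ V₁ y)
    (hx : ContinuousOn x (Ici 0)) (hxM : ∀ t, 0 ≤ t → x t ∈ M)
    (hφ : ∀ t, 0 ≤ t → HasDerivWithinAt (V₁ ∘ x) (LV₁ (x t)) (Ici t) t)
    (h0G : x 0 ∈ G) (h0c : V₁ (x 0) ≤ c₁) :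
    ∃ t₀, 0 ≤ t₀ ∧ t₀ ≤ (c₁ - m) / ε ∧ V₀ (x t₀) ≤ c₀ ∧
      ∀ t ∈ Icc 0 t₀, x t ∈ G ∧ V₁ (x t) ≤ c₁ := by
  have hm0 : m ≤ c₁ := (hm _ ⟨hxM 0 le_rfl, h0G⟩ h0c).trans h0c
  -- a horizon after which the funnel would be exhausted
  set T : ℝ := (c₁ - m) / ε + 1 with hT
  have hT0 : 0 ≤ T := by
    have : 0 ≤ (c₁ - m) / ε := div_nonneg (by linarith) hε.le
    linarith
  -- the closed set of target times in [0, T]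
  set A : Set ℝ := Icc 0 T ∩ {t | V₀ (x t) ≤ c₀} with hA
  have hAc : IsClosed A := by
    have hc : ContinuousOn (fun t ↦ V₀ (x t)) (Icc 0 T) :=
      hV₀.comp_continuousOn (hx.mono fun s hs ↦ hs.1)
    exact hc.preimage_isClosed_of_isClosed isClosed_Icc isClosed_Iic
  -- it is nonempty: otherwise trapping on [0, T] contradicts the lower bound m
  have hAne : A.Nonempty := by
    by_contra hne
    rw [not_nonempty_iff_eq_empty] at hne
    have hnot : ∀ t ∈ Ico 0 T, c₀ < V₀ (x t) := by
      intro t ht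
      by_contra hle
      have : t ∈ A := ⟨Ico_subset_Icc_self ht, not_lt.1 hle⟩
      rw [hne] at this
      exact this
    have h := forall_mem_funnel_of_not_reached hS hfence hV₁ hε hLie (hx.mono fun s hs ↦ hs.1)
      (fun t ht ↦ hxM t ht.1) (fun t ht ↦ hφ t ht.1) hnot h0G h0c T ⟨hT0, le_rfl⟩
    have hmT := hm _ ⟨hxM T hT0, h.1.1⟩ h.1.2
    have hεT : ε * T = (c₁ - m) + ε := by
      rw [hT, mul_add, mul_div_cancel₀ _ hε.ne', mul_one]
    linarith [h.2]
  -- first target time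
  have hAK : IsCompact A := isCompact_Icc.of_isClosed_subset hAc inter_subset_left
  obtain ⟨t₀, ⟨ht₀I, ht₀V⟩, hleast⟩ := hAK.exists_isLeast hAne
  -- before t₀ the target is not reached
  have hnot : ∀ t ∈ Ico 0 t₀, c₀ < V₀ (x t) := by
    intro t ht
    by_contra hle
    have htA : t ∈ A := ⟨⟨ht.1, ht.2.le.trans ht₀I.2⟩, not_lt.1 hle⟩
    exact absurd (hleast htA) (not_le.2 ht.2)
  have h := forall_mem_funnel_of_not_reached hS hfence hV₁ hε hLie (hx.mono fun s hs ↦ hs.1)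
    (fun t ht ↦ hxM t ht.1) (fun t ht ↦ hφ t ht.1) hnot h0G h0c
  refine ⟨t₀, ht₀I.1, ?_, ht₀V, fun t ht ↦ (h t ht).1⟩
  -- time bound from V₁ (x t₀) ≤ c₁ - ε t₀ and m ≤ V₁ (x t₀)
  have h1 := h t₀ ⟨ht₀I.1, le_rfl⟩
  have hmt := hm _ ⟨hxM t₀ ht₀I.1, h1.1.1⟩ h1.1.2
  rw [le_div_iff₀ hε]
  nlinarith [h1.2]

end Summit.Ventures.GridStability.Lyapunov

end
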